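import Literature.AlgebraicGeometry.AbelianSchemes.PolarizationLevelBaseQuotientDescent
import Literature.AlgebraicGeometry.AbelianSchemes.DualPairBaseQuotientDescent
import Literature.AlgebraicGeometry.AbelianSchemes.PolarizationUnitHypothesis
import Literature.AlgebraicGeometry.Morphisms.RelDimOfEtaleSurjectiveComp
import Literature.AlgebraicGeometry.Morphisms.ReducedOfFlat
import Literature.AlgebraicGeometry.RelativeSpec.GeometricQuotientFreeEtale
import HarnessLib

/-!
# The polarised triple with level structure descends along a free finite quotient OF THE BASE — assembly
# ([MFK94] Ch. 7 §3, remark after Thm. 7.9 and Lemma 7.11 — the level-lowering step `A_{g,δ,N} = A_{g,δ,NK}/Γ`; SGA 1 VIII 7.8)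

Topic `AlgebraicGeometry/AbelianSchemes`; namespace `Literature.AlgebraicGeometry.AbelianSchemes.PolarizedAbelianSchemeWithLevel`.
THEOREMS ONLY (no definition, no named fact, no instance, no notation, no `sorry`; net Literature debt 0).  Cell
hodgecm-mathlib (D-0151), F-DAG price sheet leaf F-10 (10a) «the universal triple DESCENDS along the free finite quotient
of the base `M → M/Γ`» — THE HEAD: assembly of ★ `AbelianSchemeBaseQuotientDescent` (`A`, `Â` descend — consumed as the
hypotheses `hAB`, `hÂB̂`), ★ `DualPairBaseQuotientDescent` (the dual pair `(B̂, 𝒫_B)` with `(π ×_p π̂)^*𝒫_B ≅ 𝒫`), ★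
`PolarizationLevelBaseQuotientDescent` (polarisation, type, level structure, symplectic liftability) and the relative
dimension (through the étale surjection `π`, ★ `smoothOfRelativeDimension_of_comp_eq_of_etale`) into ONE theorem
`exists_triple_desc_of_free_base_quotient : … X.IsBaseChangeVia X_Q p π π̂` from the `Γ`-isomorphisms of triples
`hX : ∀ γ, X.IsBaseChangeVia X (ρ γ) (ρA γ) (ρÂ γ)`.  What is left of F-10 (10a) after this file is only moduli-specific:
producing `ρA`, `ρÂ`, `hX` from `classify` of `A_{g,δ,NK}` and the twisted level structures, and the quotients `B`, `B̂`
(★ `exists_grpObj_isBaseChangeVia_of_free_base_quotient`).  EDITION 2 (repair road R2⁺, director s259/s260, cell finding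
8aea22b3): the moduli triple ★ `PolarizedAbelianSchemeWithLevel` now carries the field `hatNormalised`
(`(1_X × ε_X̂)^*𝒫 ≅ 𝒪`, [MumfordFogartyKirwan1994, Ch. 6 §2 (p. 121)]); for the DESCENDED dual pair `(B̂, 𝒫_B)` it is
supplied here with no new hypothesis: `B̂` is reduced (`π̂` is a base change of the étale surjection `p`, ★
`Morphisms.isReduced_of_flat_of_surjective`), hence so is `Q` (under the smooth surjection `B̂ → Q`), and over a reduced
base a polarised dual pair satisfies the unit clause (★ `Polarization.nonempty_unitHatSlice_iso`).  HC_CM is proved only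
modulo the 7 printed citations until rung 0 closes; this file discharges none of them (count-neutral capital).

Mathlib searched (pin): `MorphismProperty.IsStableUnderBaseChange.of_isPullback` (`Etale`, `Surjective`),
`SmoothOfRelativeDimension` of a composite with an étale map, `Smooth ⇒ Flat` (`Morphisms/Smooth`) (used).

## References
* D. Mumford, J. Fogarty, F. Kirwan, *Geometric Invariant Theory*, 3rd ed. (1994), Ch. 7 §2 Definition 7.2 (p. 129); §3,
  remark after Thm. 7.9 and Lemma 7.11 (pp. 139–140). [MumfordFogartyKirwan1994]
* A. Grothendieck, *SGA 1*, Exp. VIII Cor. 7.8. [SGA1]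
* K.-W. Lan, *Arithmetic compactifications of PEL-type Shimura varieties* (2013), Rem. 1.4.1.9 (p. 90), Cor. 1.4.1.12 (p. 91). [Lan2013PELCompactifications]
-/

noncomputable section

universe u

open CategoryTheory Limits AlgebraicGeometry MonoidalCategory CartesianMonoidalCategory MonObj

set_option backward.isDefEq.respectTransparency false

/-! ### §6 Assembly: the polarised triple with level structure descends -/

namespace Literature.AlgebraicGeometry.AbelianSchemes.PolarizedAbelianSchemeWithLevel

open Literature.AlgebraicGeometry.RelativeSpec Literature.AlgebraicGeometry.RelativeSpec.ActionOver
  Literature.AlgebraicGeometry.Modules Literature.AlgebraicGeometry.Motives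
  Literature.AlgebraicGeometry.AbelianVarieties Literature.AlgebraicGeometry.Morphisms AbelianSchemeOver

variable {S Q : Scheme.{u}} {p : S ⟶ Q} {G : Type u} [Group G] [Fintype G] {ρ : ActionOver p G}
  (hq : ρ.IsGeometricQuotient p) [IsAffineHom p]
  (hfree : ∀ (V : Q.Opens), IsAffineOpen V → ∀ g : G, g ≠ 1 →
    Ideal.span (Set.range fun s : Γ(S, p ⁻¹ᵁ V) ↦ ρ.act g V s - s) = ⊤)

include hq hfree in
/-- **THE UNIVERSAL TRIPLE DESCENDS ALONG A FREE FINITE QUOTIENT OF THE BASE** ([MumfordFogartyKirwan1994] Ch. 7 §3,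
remark after Thm. 7.9 and Lemma 7.11: the level-lowering step `A_{g,δ,N} = A_{g,δ,NK}/Γ`).  Let `p : S → Q = S/G` be
an affine geometric quotient by a FREE action of the finite group `G`, locally of finite type, `Q` locally Noetherian;
`X = (A, Â, 𝒫, λ, σ)` a polarised abelian scheme of type `δ` with symplectic-liftable level-`N` structure over `S`, `Â`
reduced and locally Noetherian; `B`, `B̂` abelian schemes over `Q` (separated total spaces) with `π : A → B`,
`π̂ : Â → B̂` exhibiting `A`, `Â` as the base changes along `p` AS GROUP SCHEMES (★
`exists_grpObj_isBaseChangeVia_of_free_base_quotient` applied to `A` and to `Â`); and `G`-actions `ρA`, `ρÂ` on `A`,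
`Â` over `π`, `π̂` such that **for every `γ` the pair `(ρA(γ), ρÂ(γ))` is an ISOMORPHISM OF TRIPLES `X → X` over
`ρ(γ)`** (`hX : X.IsBaseChangeVia X (ρ γ) (ρA γ) (ρÂ γ)` — what `classify` of a fine moduli scheme hands over).  THEN
`X` DESCENDS: there are a relative dimension, a Poincaré sheaf `𝒫_B` making `(B̂, 𝒫_B)` a dual pair of `B`, a
polarisation `λ_B` of type `δ`, and a symplectic-liftable level-`N` structure `ψ` on `B`, such that `(π, π̂)` exhibits
`X` as the base change along `p` of the triple `X_Q := (B, B̂, 𝒫_B, λ_B, ψ)` — ★ `PolarizedAbelianSchemeWithLevel.IsBaseChangeVia`,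
all five clauses.  (Assembly of ★ `exists_dualPair_fields_of_free_base_quotient`, §2–§5, and the relative dimension
through the étale surjection `π`, ★ `smoothOfRelativeDimension_of_comp_eq_of_etale`; edition 2: the unit clause `hN` of
`(B̂, 𝒫_B)` — `B̂`, hence `Q`, is reduced, ★ `Morphisms.isReduced_of_flat_of_surjective`, and ★
`Polarization.nonempty_unitHatSlice_iso` applies to `λ_B`.)  The fields are listed one by one so that the consumer keeps
`X_Q.A = B`, `X_Q.D.hat = B̂` definitionally.
[cite: MumfordFogartyKirwan1994, Ch. 7 §3, remark after Thm. 7.9 and Lemma 7.11 (pp. 139–140)]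
[cite: MumfordFogartyKirwan1994, Ch. 6 §2 (p. 121)]
[cite: MumfordFogartyKirwan1994, Ch. 7 §2 Definition 7.2 (p. 129)] [cite: SGA1, Exp. VIII Cor. 7.8]
[cite: Lan2013PELCompactifications, Rem. 1.4.1.9 (p. 90)] -/
theorem exists_triple_desc_of_free_base_quotient [LocallyOfFiniteType p] [IsLocallyNoetherian Q] {g₀ N : ℕ}
    {δ : Fin g₀ → ℕ} (X : PolarizedAbelianSchemeWithLevel g₀ N δ S)
    [IsReduced X.D.hat.X.left] [IsLocallyNoetherian X.D.hat.X.left]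
    (B : AbelianSchemeOver Q) [B.X.left.IsSeparated] {π : X.A.X.left ⟶ B.X.left} (hAB : X.A.IsBaseChangeVia B p π)
    (ρA : ActionOver π G)
    (Bh : AbelianSchemeOver Q) [Bh.X.left.IsSeparated] {πh : X.D.hat.X.left ⟶ Bh.X.left}
    (hABh : X.D.hat.IsBaseChangeVia Bh p πh) (ρh : ActionOver πh G)
    (hX : ∀ g : G, X.IsBaseChangeVia X (ρ.aut g).hom (ρA.aut g).hom (ρh.aut g).hom) :
    ∃ (hrel : B.IsOfRelDim g₀) (PB : (B.prodLeft Bh).Modules) (h1 : HasRank PB 1)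
      (hrig : Nonempty ((Scheme.Modules.pullback (B.unitSlice Bh)).obj PB ≅ SheafOfModules.unit _))
      (hpic : ∀ (Ω : Type u) [Field Ω] [IsAlgClosed Ω] (b : Spec (.of Ω) ⟶ Bh.X.left),
        IsHomogeneous (B.fibre (b ≫ Bh.X.hom)).toAbelianVariety
          ((Scheme.Modules.pullback (B.fibreSlice Bh b)).obj PB))
      (huniv : ∀ {T : Scheme.{u}} (f : T ⟶ Q) (ℒ : B.RigidifiedLineBundle f), ℒ.FibrewisePicZero →
        ∃! g : {g : T ⟶ Bh.X.left // g ≫ Bh.X.hom = f},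
          Nonempty ((Scheme.Modules.pullback (B.baseChangeToProd Bh f g.1 g.2)).obj PB ≅ ℒ.L))
      (polB : B.Polarization ⟨Bh, PB, h1, hrig, hpic, huniv⟩) (hT : polB.HasType δ)
      (ψ : AbelianSchemeOver.LevelStructure g₀ N B) (hsymp : ψ.IsSymplecticLiftable polB δ)
      (hN : Nonempty ((Scheme.Modules.pullback
        (DualPair.unitHatSlice (⟨Bh, PB, h1, hrig, hpic, huniv⟩ : B.DualPair))).obj PB ≅ SheafOfModules.unit _)),
      X.IsBaseChangeVia ⟨B, hrel, ⟨Bh, PB, h1, hrig, hpic, huniv⟩, polB, hT, ψ, hsymp, hN⟩ p π πh := by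
  haveI : Surjective p := ⟨hq.surjective⟩
  -- unpack the `G`-isomorphisms of triples
  have hA' : ∀ g : G, X.A.IsBaseChangeVia X.A (ρ.aut g).hom (ρA.aut g).hom := fun g => (hX g).1.1
  have hAh' : ∀ g : G, X.D.hat.IsBaseChangeVia X.D.hat (ρ.aut g).hom (ρh.aut g).hom := fun g => (hX g).2.1
  have hA : ∀ g : G, (ρA.aut g).hom ≫ X.A.X.hom = X.A.X.hom ≫ (ρ.aut g).hom := fun g => (hA' g).fst
  have hP : ∀ g : G, Nonempty ((Scheme.Modules.pullback
      (pullback.map X.A.X.hom X.D.hat.X.hom X.A.X.hom X.D.hat.X.hom (ρA.aut g).hom (ρh.aut g).hom (ρ.aut g).hom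
        (hA' g).fst.symm (hAh' g).fst.symm)).obj X.D.P ≅ X.D.P) := fun g => by
    obtain ⟨-, -, ⟨wG, wĜ, hne⟩, -⟩ := hX g
    exact hne
  have hlam : ∀ g : G, (ρA.aut g).hom ≫ X.pol.lam.left = X.pol.lam.left ≫ (ρh.aut g).hom :=
    fun g => ((hX g).2.2.2).symm
  have hlev : ∀ (g : G) (i : Fin g₀ ⊕ Fin g₀), (ρ.aut g).hom ≫ (X.level.σ i).left = (X.level.σ i).left ≫ (ρA.aut g).hom :=
    fun g i => ((hX g).1.2 i).symm
  -- the dual pair (★ `DualPairBaseQuotientDescent`)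
  obtain ⟨PB, h1, hrig, hpic, huniv, ⟨ePB⟩⟩ :=
    exists_dualPair_fields_of_free_base_quotient hq hfree X.A X.D B ρA hAB hA' Bh ρh hABh hAh' hP
  let DB : B.DualPair := ⟨Bh, PB, h1, hrig, hpic, huniv⟩
  have hABh' : X.D.hat.IsBaseChangeVia DB.hat p πh := hABh
  -- the polarisation, its type, the level structure, its symplectic liftability (§2–§5)
  obtain ⟨polB, hcomm⟩ :=
    Polarization.exists_desc_of_isBaseChangeVia hq hfree hAB ρA hA X.D DB hABh' ρh X.pol ⟨ePB⟩ hlam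
  have hT : polB.HasType δ := Polarization.hasType_of_isBaseChangeVia hAB X.D DB hABh' X.pol polB hcomm X.hasType
  obtain ⟨ψ, hψ⟩ := LevelStructure.exists_desc_of_isBaseChangeVia hq hfree hAB ρA hA X.level hlev
  have hsymp : ψ.IsSymplecticLiftable polB δ :=
    LevelStructure.isSymplecticLiftable_of_isBaseChangeVia hAB X.D DB hABh' X.level ψ hψ X.pol polB hcomm ⟨ePB⟩ δ
      X.symplectic
  -- the relative dimension through the étale surjection `π`
  have hrel : B.IsOfRelDim g₀ := by
    haveI : Etale p := hq.etale_of_free hfree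
    haveI : Etale π := MorphismProperty.IsStableUnderBaseChange.of_isPullback hAB.snd.1.flip inferInstance
    haveI : Surjective π := MorphismProperty.IsStableUnderBaseChange.of_isPullback hAB.snd.1.flip inferInstance
    haveI : SmoothOfRelativeDimension g₀ X.A.X.hom := X.relDim
    haveI : Smooth B.X.hom := B.isSmooth
    have hcomp : SmoothOfRelativeDimension (g₀ + 0) (X.A.X.hom ≫ p) := inferInstance
    rw [Nat.add_zero] at hcomp
    exact smoothOfRelativeDimension_of_comp_eq_of_etale π B.X.hom (X.A.X.hom ≫ p) hAB.fst g₀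
  -- edition 2: the unit clause of the descended dual pair — `B̂`, hence `Q`, is reduced; then ★ `PolarizationUnitHypothesis`
  have hN : Nonempty ((Scheme.Modules.pullback (DualPair.unitHatSlice DB)).obj DB.P ≅ SheafOfModules.unit _) := by
    haveI : Etale p := hq.etale_of_free hfree
    haveI : Etale πh := MorphismProperty.IsStableUnderBaseChange.of_isPullback hABh.snd.1.flip inferInstance
    haveI : Surjective πh := MorphismProperty.IsStableUnderBaseChange.of_isPullback hABh.snd.1.flip inferInstance
    haveI : IsReduced Bh.X.left := isReduced_of_flat_of_surjective πh
    haveI : Smooth Bh.X.hom := Bh.isSmooth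
    haveI : Surjective Bh.X.hom := ⟨fun q => ⟨Bh.unitSection q, by
      rw [← Scheme.Hom.comp_apply Bh.unitSection Bh.X.hom q, Bh.unitSection_comp_hom]; rfl⟩⟩
    haveI : IsReduced Q := isReduced_of_flat_of_surjective Bh.X.hom
    exact Polarization.nonempty_unitHatSlice_iso polB
  refine ⟨hrel, PB, h1, hrig, hpic, huniv, polB, hT, ψ, hsymp, hN, ?_⟩
  exact ⟨⟨hAB, hψ⟩, hABh, ⟨hAB.fst.symm, hABh.fst.symm, ⟨ePB⟩⟩, hcomm⟩

end Literature.AlgebraicGeometry.AbelianSchemes.PolarizedAbelianSchemeWithLevel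

end
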